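import Mathlib
import Summits.Ventures.PercRepro2.Defs
import Summits.Ventures.PercRepro2.Graph
import Summits.Ventures.PercRepro2.OneColourSwitch
import Summits.Ventures.PercRepro2.RegionHubSign
import Summits.Ventures.PercRepro2.SideSwitch
import Summits.Ventures.PercRepro2.TermSwitchDefs
import Summits.Ventures.PercRepro2.M9NoPocketDefs
import Summits.Ventures.PercRepro2.M9PsiOneDefs
import Summits.Ventures.PercRepro2.M9PsiOneWorlds
import Summits.Ventures.PercRepro2.M9PsiOneWorldsM
import Summits.Ventures.PercRepro2.M9PsiOneSurvive
import Summits.Ventures.PercRepro2.M9PsiOneLink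

/-!
# `Ψ₁` kills the `W`-link of `r, s` (blind cell PercRepro2, p3 g31, 2026-08-28;
`proofs/P3-PAYMENT.md` §2, claim (ii), second half)

A `W`-path `r → s` of `Ψ₁ ω` ends with a closed edge `x–s` of `Ψ₁ ω`; `x` can only be a vertex
of `Fnl` (every other class gives an open edge at `s` in `Ψ₁ ω`), and the `W`-path to `x`
avoiding `s` stays inside `x`'s block, where the closed edges of `Ψ₁ ω` are the open edges of
`ω` (`rooted_compl_of_conn_avoid`); with the last edge (open in `ω`) the block is linking in `ω`
— against `x ∈ Fnl`.  Hence `r ≁_W s` in `Ψ₁ ω` (`not_conn_compl_psiOne_rs`) and, with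
`M9PsiOneLink`, `σ_rs(Ψ₁ ω) = 1` whenever `r ~_Y s` in `ω` (`sigma_rs_psiOne`).  Own work;
std axioms.
-/

namespace Summit.Ventures.PercRepro2

namespace NoPocket

open Finset Classical RegionHub OneColourSwitch SideSwitch TermSwitch

variable {V : Type*} {E : Type*}

section LinkW

variable {ends : E → Sym2 V} {p q r s d : V} {ω : Config E}

/-- An edge is open in the colour flip of `Ψ₁ ω` iff it is closed in `Ψ₁ ω`. -/
lemma compl_psiOne_eq_true_iff {e : E} :
    OneColourSwitch.compl (psiOne ends r s d ω) e = true ↔ psiOne ends r s d ω e = false := by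
  simp [OneColourSwitch.compl]

variable (h : IsEX ends p q r s d ω)
include h

/-- A vertex of `Fnl` reached from `r` in the colour flip of `Ψ₁ ω` avoiding `s` is reached from
`r` inside its block in `ω`. -/
lemma rooted_compl_of_conn_avoid {x : V} (hx : x ∈ Fnl ends r s d ω)
    (hc : Conn ends (avoidAt ends (OneColourSwitch.compl (psiOne ends r s d ω)) s) r x) :
    Conn ends (restrictTo ends ω (blockIn ends (Kcore ends r s d ω) x ∪ {r, s})) r x := by
  set B := blockIn ends (Kcore ends r s d ω) x with hB
  have hBK : B ⊆ Kcore ends r s d ω := blockIn_subset hx.1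
  have hBF : B ⊆ Fnl ends r s d ω := blockIn_subset_Fnl hx
  have hrB : r ∉ B := fun hr => term_not_mem_Kcore (Or.inl rfl) (hBK hr)
  have key : x ∈ {y | y ∉ B ∨ Conn ends (restrictTo ends ω (B ∪ {r, s})) r y} := by
    refine mem_of_conn_of_closed (ends := ends)
      (ω := avoidAt ends (OneColourSwitch.compl (psiOne ends r s d ω)) s) ?_ (Or.inl hrB) hc
    intro y₁ hy₁ y₂ hy
    obtain ⟨hne, e, he₀, hends⟩ := openGraph_adj.1 hy
    obtain ⟨hse, he⟩ := avoidAt_eq_true he₀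
    have he' : psiOne ends r s d ω e = false := compl_psiOne_eq_true_iff.1 he
    simp only [Set.mem_setOf_eq] at hy₁ ⊢
    by_cases hy₂B : y₂ ∈ B
    · right
      have hy₂K : y₂ ∈ Kcore ends r s d ω := hBK hy₂B
      have hy₂F : y₂ ∈ Fnl ends r s d ω := hBF hy₂B
      rcases vertex_cases (ends := ends) (r := r) (s := s) (d := d) (ω := ω) y₁ with
        hy₁' | hy₁' | hy₁' | hy₁K | hy₁M | hy₁O
      · rw [hy₁'] at hends
        have hω : ω e = true := edge_Kcore_term h hy₂K (Or.inl rfl) (ends_swap hends)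
        exact conn_of_openAdj ⟨e,
          by rw [restrictTo_eq (S := B ∪ {r, s}) (by simp) (Or.inl hy₂B) hends]; exact hω, hends⟩
      · exact (hse (by rw [hends, hy₁']; exact Sym2.mem_mk_left _ _)).elim
      · rw [hy₁'] at hends
        exact (hx.2.1 (mem_joinedY_of_conn (mem_joinedY_of_nbr hy₂K hends) (conn_symm hy₂B))).elim
      · have hy₁B : y₁ ∈ B := mem_blockIn_of_edge hy₂B hy₁K hy₂K (ends_swap hends)
        have hc₁ : Conn ends (restrictTo ends ω (B ∪ {r, s})) r y₁ := by
          rcases hy₁ with hy₁ | hy₁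
          · exact (hy₁ hy₁B).elim
          · exact hy₁
        -- the edge is inside `Fnl`: flipped, so open in `ω`
        have hk := not_kept (ω := ω) hends (not_mem_union_of_mem_Fnl (hBF hy₁B))
          (not_mem_union_of_mem_Fnl hy₂F) (fun hyd => (hy₁K.2.2.2 hyd).elim)
          (fun hyd => (hy₂K.2.2.2 hyd).elim)
        have hω : ω e = true := by
          rw [psiOne_of_not_kept hk] at he'
          cases hω : ω e
          · rw [hω] at he'; exact absurd he' (by decide)
          · rfl
        exact conn_trans hc₁ (conn_of_openAdj ⟨e,
          by rw [restrictTo_eq (S := B ∪ {r, s}) (Or.inl hy₁B) (Or.inl hy₂B) hends]; exact hω, hends⟩)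
      · exact (no_edge_core_core h hy₂K hy₁M (ends_swap hends)).elim
      · rw [psiOne_Fnl_out h hy₂F hy₁O (ends_swap hends)] at he'; exact absurd he' (by decide)
    · exact Or.inl hy₂B
  rcases key with key | key
  · exact (key (mem_blockIn_self _ _)).elim
  · exact key

/-- **`r ≁_W s` in `Ψ₁ ω`** (no `r–s` edge). -/
theorem not_conn_compl_psiOne_rs (hrs : ∀ e, ends e ≠ s(r, s)) :
    ¬ Conn ends (OneColourSwitch.compl (psiOne ends r s d ω)) r s := by
  intro hc
  obtain ⟨x, e, hcx, he, hends⟩ := exists_last_edge h.hrs hc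
  have he' : psiOne ends r s d ω e = false := compl_psiOne_eq_true_iff.1 he
  rcases vertex_cases (ends := ends) (r := r) (s := s) (d := d) (ω := ω) x with
    hx | hx | hx | hxK | hxM | hxO
  · exact hrs e (hx ▸ hends)
  · exact ne_of_conn_avoidAt h.hrs hcx hx
  · exact no_edge_d_term h (Or.inr rfl) (hx ▸ hends)
  · have hω : ω e = true := edge_Kcore_term h hxK (Or.inr rfl) hends
    rcases Kcore_cases hxK with hxJ | hxF
    · rw [psiOne_of_kept (mem_keptEdges_of_touches hxJ hends), hω] at he'
      exact absurd he' (by decide)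
    · have hrx := rooted_compl_of_conn_avoid h hxF hcx
      have hlink : Conn ends (restrictTo ends ω (blockIn ends (Kcore ends r s d ω) x ∪ {r, s})) r s :=
        conn_trans hrx (conn_of_openAdj ⟨e,
          by rw [restrictTo_eq (S := blockIn ends (Kcore ends r s d ω) x ∪ {r, s})
            (Or.inl (mem_blockIn_self _ _)) (by simp) hends]; exact hω, hends⟩)
      exact hxF.2.2 ⟨hxK, hlink⟩
  · rw [psiOne_term_Mcore h (Or.inr rfl) hxM (ends_swap hends)] at he'; exact absurd he' (by decide)
  · exact no_edge_out_term h hxO (Or.inr rfl) (ends_swap hends)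

/-- **`σ_rs(Ψ₁ ω) = 1` whenever `r ~_Y s` in `ω`** (no `r–s` edge). -/
theorem sigma_rs_psiOne [Fintype E] [DecidableEq E] (hrs : ∀ e, ends e ≠ s(r, s))
    (hc : Conn ends ω r s) : sigma ends (psiOne ends r s d ω) r s = 1 := by
  unfold sigma
  rw [if_pos (conn_psiOne_rs h hrs hc), if_neg (not_conn_compl_psiOne_rs h hrs)]
  rfl

end LinkW

end NoPocket

end Summit.Ventures.PercRepro2
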